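import Literature.Probability.Percolation.ZdFrontierEvent
import Literature.Probability.Percolation.FiniteEnergy
import HarnessLib

/-!
# Rings around the tip, read on fresh pairs: `P(E_S ∩ ⋂_k G_kᶜ) = P(E_S) ∏_k (1 - P(G_k))`

Topic `Literature/Probability/Percolation`; bond percolation on `ℤ² = Site 2`.  DEFINITIONS
with bodies (`openedOn`, `closedOn`) and PROOFS (no named fact).  A brick of the EXTERNAL
per-scale lemma of Kesten's arm-separation theorem for four alternating arms of bond percolation
on `ℤ²`, cluster–frontier form (`ZdFrontierEvent.lean`): the probabilistic mechanism of
P. Nolin, EJP 13 (2008), §4.4, proof of Lemma 15 [arXiv 0711.4948: Lemma 14, p. 11] — "if we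
condition on `E_u`, percolation there remains unbiased and we can use the RSW theorem … Look at
the disjoint annuli centered on `z_u` … With probability at least `1 - (1-δ'')^{-C log η}` we
observe a … circuit in one of the annuli" — WITHOUT conditioning: for a frontier set `S` the
event `E_S = frontierEvent M N S` is determined by the below pairs `belowPairs M N S`
(`determinedBy_frontierEvent`), so any events `G_k` determined by pairwise disjoint sets of
pairs avoiding the below pairs are jointly independent of `E_S` under the product measure
(`bondPercolation_real_inter_of_disjoint`), whence

  `P(E_S ∩ ⋂_{k<K} G_kᶜ) = P(E_S) · ∏_{k<K} (1 - P(G_k)) ≤ P(E_S) (1 - c)^K`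

(`real_inter_biInter_compl_eq`, `real_inter_biInter_compl_le`).  The ring events around the tip
are read on fresh pairs only by COMPLETING the configuration on the below pairs in the worst
case: for an increasing event `A` (open crossings) `openedOn B A = {ω | ω ∪ B ∈ A}`, for a
decreasing one (closed dual crossings) `closedOn B A = {ω | ω ∖ B ∈ A}`; these are determined
by the pairs of `A` off `B` (`determinedBy_openedOn`, `determinedBy_closedOn`), contain `A`
(`subset_openedOn`, `subset_closedOn`: so their probability is at least the RSW bound for `A`),
and on them the crossings exist in the completed configuration, whose fresh open (closed) edges
are open (closed) in `ω` — which is all the tip catch `LowPath.exists_tipCatch` and the blocking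
lemmas use.  Assembled: `real_frontierEvent_inter_biInter_compl_openedOn_le` and
`real_frontierEvent_inter_biInter_compl_closedOn_le`.

## References

* P. Nolin, *Near-critical percolation in two dimensions*, EJP 13 (2008), §4.4, proof of
  Lemma 15 (arXiv 0711.4948: Lemma 14, p. 11) [Nolin2008].
* H. Kesten, *Scaling relations for 2D-percolation*, CMP 109 (1987), §2, Lemma 4
  [KestenScalingCMP1987].
* B. Bollobás, O. Riordan, *Percolation* (2006), Ch. 3, proof of Thm. 6 ("As the `A_k` are
  disjoint, the events `E_k` are independent") [BollobasRiordan2006].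

## Tree

`frontierEvent`, `belowPairs`, `determinedBy_frontierEvent`, `measurableSet_frontierEvent`
(`ZdFrontierEvent.lean`); `DeterminedBy`, `determinedBy_iff`, `DeterminedBy.mono`,
`DeterminedBy.measurableSet_of_finset` (`PercolationEvents.lean`);
`bondPercolation_real_inter_of_disjoint` (`FiniteEnergy.lean`). Mathlib:
`probReal_compl_eq_one_sub`, `Finset.prod_range_succ`, `Finset.set_biInter_insert`.
-/

noncomputable section

open Finset

namespace Literature.Probability.Percolation

open LatticeModels _root_.MeasureTheory

variable {A : Set (BondConfig (Site 2))} {B P : Finset (Sym2 (Site 2))}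

/-! ### Completing a configuration on a set of pairs -/

/-- **`A` after opening the pairs of `B`**: the configurations `ω` with `ω ∪ B ∈ A`. [folklore] -/
def openedOn (B : Finset (Sym2 (Site 2))) (A : Set (BondConfig (Site 2))) : Set (BondConfig (Site 2)) :=
  {ω | ω ∪ ↑B ∈ A}

/-- **`A` after closing the pairs of `B`**: the configurations `ω` with `ω ∖ B ∈ A`. [folklore] -/
def closedOn (B : Finset (Sym2 (Site 2))) (A : Set (BondConfig (Site 2))) : Set (BondConfig (Site 2)) :=
  {ω | ω \ ↑B ∈ A}

/-- Membership in `openedOn`. [folklore] -/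
@[simp] theorem mem_openedOn_iff {ω : BondConfig (Site 2)} : ω ∈ openedOn B A ↔ ω ∪ ↑B ∈ A := Iff.rfl

/-- Membership in `closedOn`. [folklore] -/
@[simp] theorem mem_closedOn_iff {ω : BondConfig (Site 2)} : ω ∈ closedOn B A ↔ ω \ ↑B ∈ A := Iff.rfl

/-- An increasing event is contained in its opened-on version. [folklore] -/
theorem subset_openedOn (hA : IsUpperSet A) (B : Finset (Sym2 (Site 2))) : A ⊆ openedOn B A :=
  fun _ hω => hA Set.subset_union_left hω

/-- A decreasing event is contained in its closed-on version. [folklore] -/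
theorem subset_closedOn (hA : IsLowerSet A) (B : Finset (Sym2 (Site 2))) : A ⊆ closedOn B A :=
  fun _ hω => hA Set.sdiff_subset hω

/-- **`openedOn B A` is read off the pairs of `A` off `B`.** [folklore] -/
theorem determinedBy_openedOn (hA : DeterminedBy A ↑P) (B : Finset (Sym2 (Site 2))) :
    DeterminedBy (openedOn B A) ↑(P \ B) := by
  rw [determinedBy_iff] at hA ⊢
  intro ω ω' h
  simp only [mem_openedOn_iff]
  refine hA _ _ (Set.ext fun e => ?_)
  simp only [Set.mem_inter_iff, Set.mem_union, Finset.mem_coe]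
  by_cases heB : e ∈ B
  · simp [heB]
  · have key : e ∈ P → (e ∈ ω ↔ e ∈ ω') := fun heP =>
      ⟨fun h1 => ((Set.ext_iff.1 h e).1 ⟨h1, Finset.mem_coe.2 (Finset.mem_sdiff.2 ⟨heP, heB⟩)⟩).1,
        fun h1 => ((Set.ext_iff.1 h e).2 ⟨h1, Finset.mem_coe.2 (Finset.mem_sdiff.2 ⟨heP, heB⟩)⟩).1⟩
    constructor
    · rintro ⟨h1 | h1, heP⟩
      · exact ⟨Or.inl ((key heP).1 h1), heP⟩
      · exact absurd h1 heB
    · rintro ⟨h1 | h1, heP⟩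
      · exact ⟨Or.inl ((key heP).2 h1), heP⟩
      · exact absurd h1 heB

/-- **`closedOn B A` is read off the pairs of `A` off `B`.** [folklore] -/
theorem determinedBy_closedOn (hA : DeterminedBy A ↑P) (B : Finset (Sym2 (Site 2))) :
    DeterminedBy (closedOn B A) ↑(P \ B) := by
  rw [determinedBy_iff] at hA ⊢
  intro ω ω' h
  simp only [mem_closedOn_iff]
  refine hA _ _ (Set.ext fun e => ?_)
  simp only [Set.mem_inter_iff, Set.mem_sdiff, Finset.mem_coe]
  by_cases heB : e ∈ B
  · simp [heB]
  · have key : e ∈ P → (e ∈ ω ↔ e ∈ ω') := fun heP =>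
      ⟨fun h1 => ((Set.ext_iff.1 h e).1 ⟨h1, Finset.mem_coe.2 (Finset.mem_sdiff.2 ⟨heP, heB⟩)⟩).1,
        fun h1 => ((Set.ext_iff.1 h e).2 ⟨h1, Finset.mem_coe.2 (Finset.mem_sdiff.2 ⟨heP, heB⟩)⟩).1⟩
    constructor
    · rintro ⟨⟨h1, -⟩, heP⟩
      exact ⟨⟨(key heP).1 h1, heB⟩, heP⟩
    · rintro ⟨⟨h1, -⟩, heP⟩
      exact ⟨⟨(key heP).2 h1, heB⟩, heP⟩

/-- `openedOn B A` is measurable (local). [folklore] -/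
theorem measurableSet_openedOn (hA : DeterminedBy A ↑P) (B : Finset (Sym2 (Site 2))) :
    MeasurableSet (openedOn B A) :=
  (determinedBy_openedOn hA B).measurableSet_of_finset

/-- `closedOn B A` is measurable (local). [folklore] -/
theorem measurableSet_closedOn (hA : DeterminedBy A ↑P) (B : Finset (Sym2 (Site 2))) :
    MeasurableSet (closedOn B A) :=
  (determinedBy_closedOn hA B).measurableSet_of_finset

/-- The completed configuration restricted to pairs off `B` is `ω` there: a fresh pair is open in
`ω ∪ B` iff it is open in `ω`. [folklore] -/
theorem mem_of_mem_union_of_not_mem {ω : BondConfig (Site 2)} {e : Sym2 (Site 2)} (he : e ∈ ω ∪ ↑B)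
    (heB : e ∉ B) : e ∈ ω := by
  rcases he with he | he
  · exact he
  · exact absurd (Finset.mem_coe.1 he) heB

/-- A fresh pair is closed in `ω ∖ B` iff it is closed in `ω`. [folklore] -/
theorem not_mem_of_not_mem_diff_of_not_mem {ω : BondConfig (Site 2)} {e : Sym2 (Site 2)} (he : e ∉ ω \ ↑B)
    (heB : e ∉ B) : e ∉ ω :=
  fun heω => he ⟨heω, fun h => heB (Finset.mem_coe.1 h)⟩

/-! ### Independence of an event from failures determined by disjoint sets of pairs -/

/-- The intersection of complements of events determined by the `T k` is determined by their
union. [folklore] -/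
theorem determinedBy_biInter_compl_range (G : ℕ → Set (BondConfig (Site 2))) (T : ℕ → Finset (Sym2 (Site 2)))
    (hG : ∀ k, DeterminedBy (G k) ↑(T k)) (K : ℕ) :
    DeterminedBy (⋂ k ∈ Finset.range K, (G k)ᶜ) ↑((Finset.range K).biUnion T) := by
  rw [determinedBy_iff]
  intro ω ω' h
  simp only [Set.mem_iInter, Set.mem_compl_iff]
  refine forall₂_congr fun k hk => not_congr ?_
  refine (determinedBy_iff _ _).1 (hG k) ω ω' (Set.ext fun e => ?_)
  constructor
  · rintro ⟨he, heT⟩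
    exact ⟨((Set.ext_iff.1 h e).1 ⟨he, Finset.mem_coe.2 (Finset.mem_biUnion.2 ⟨k, hk, Finset.mem_coe.1 heT⟩)⟩).1, heT⟩
  · rintro ⟨he, heT⟩
    exact ⟨((Set.ext_iff.1 h e).2 ⟨he, Finset.mem_coe.2 (Finset.mem_biUnion.2 ⟨k, hk, Finset.mem_coe.1 heT⟩)⟩).1, heT⟩

/-- Measurability of the same intersection. [folklore] -/
theorem measurableSet_biInter_compl_range (G : ℕ → Set (BondConfig (Site 2))) (hGm : ∀ k, MeasurableSet (G k))
    (K : ℕ) : MeasurableSet (⋂ k ∈ Finset.range K, (G k)ᶜ) :=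
  Finset.measurableSet_biInter _ fun k _ => (hGm k).compl

/-- **Product formula**: if `E` is determined by the pairs `B` and the events `G_k` by pairwise
disjoint sets of pairs `T_k` disjoint from `B`, then for every `p`
`P_p(E ∩ ⋂_{k<K} G_kᶜ) = P_p(E) ∏_{k<K} (1 - P_p(G_k))`. [cite: BollobasRiordan2006, Ch. 3, proof of Thm. 6] -/
theorem real_inter_biInter_compl_eq (p : unitInterval) {E : Set (BondConfig (Site 2))} {B : Finset (Sym2 (Site 2))}
    (hE : DeterminedBy E ↑B) (hEm : MeasurableSet E) (G : ℕ → Set (BondConfig (Site 2)))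
    (T : ℕ → Finset (Sym2 (Site 2))) (hG : ∀ k, DeterminedBy (G k) ↑(T k)) (hGm : ∀ k, MeasurableSet (G k))
    (hTB : ∀ k, Disjoint (T k) B) (hTT : ∀ k l, k ≠ l → Disjoint (T k) (T l)) (K : ℕ) :
    (bondPercolation (zdGraph 2) p).real (E ∩ ⋂ k ∈ Finset.range K, (G k)ᶜ) =
      (bondPercolation (zdGraph 2) p).real E * ∏ k ∈ Finset.range K, (1 - (bondPercolation (zdGraph 2) p).real (G k)) := by
  induction K with
  | zero => simp
  | succ K ih =>
    rw [Finset.prod_range_succ, Finset.range_add_one, Finset.set_biInter_insert, ← mul_assoc, ← ih,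
      ← probReal_compl_eq_one_sub (hGm K), Set.inter_comm (G K)ᶜ, ← Set.inter_assoc]
    have hdet : DeterminedBy (E ∩ ⋂ k ∈ Finset.range K, (G k)ᶜ) ↑(B ∪ (Finset.range K).biUnion T) :=
      (hE.mono (Finset.coe_subset.2 Finset.subset_union_left)).inter
        ((determinedBy_biInter_compl_range G T hG K).mono (Finset.coe_subset.2 Finset.subset_union_right))
    have hdisj : Disjoint (↑(B ∪ (Finset.range K).biUnion T) : Set (Sym2 (Site 2))) ↑(T K) := by
      rw [Finset.disjoint_coe, Finset.disjoint_union_left, Finset.disjoint_biUnion_left]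
      exact ⟨(hTB K).symm, fun k hk => hTT k K (by have := Finset.mem_range.1 hk; omega)⟩
    have hcompl : DeterminedBy (G K)ᶜ (↑(T K) : Set (Sym2 (Site 2))) := by
      have := hG K
      rw [determinedBy_iff] at this ⊢
      intro ω ω' h
      rw [Set.mem_compl_iff, Set.mem_compl_iff, this ω ω' h]
    exact bondPercolation_real_inter_of_disjoint (zdGraph 2) p hdisj hdet hcompl
      (hEm.inter (measurableSet_biInter_compl_range G hGm K)) (hGm K).compl

/-- **Exponential bound**: under the same hypotheses, if `c ≤ P_p(G_k)` for all `k < K` then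
`P_p(E ∩ ⋂_{k<K} G_kᶜ) ≤ P_p(E) (1 - c)^K`. [cite: Nolin2008, §4.4, proof of Lemma 15 (arXiv 0711.4948: Lemma 14, p. 11)] -/
theorem real_inter_biInter_compl_le (p : unitInterval) {E : Set (BondConfig (Site 2))} {B : Finset (Sym2 (Site 2))}
    (hE : DeterminedBy E ↑B) (hEm : MeasurableSet E) (G : ℕ → Set (BondConfig (Site 2)))
    (T : ℕ → Finset (Sym2 (Site 2))) (hG : ∀ k, DeterminedBy (G k) ↑(T k)) (hGm : ∀ k, MeasurableSet (G k))
    (hTB : ∀ k, Disjoint (T k) B) (hTT : ∀ k l, k ≠ l → Disjoint (T k) (T l)) {K : ℕ} {c : ℝ}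
    (hc : ∀ k < K, c ≤ (bondPercolation (zdGraph 2) p).real (G k)) :
    (bondPercolation (zdGraph 2) p).real (E ∩ ⋂ k ∈ Finset.range K, (G k)ᶜ) ≤
      (bondPercolation (zdGraph 2) p).real E * (1 - c) ^ K := by
  rw [real_inter_biInter_compl_eq p hE hEm G T hG hGm hTB hTT K]
  refine mul_le_mul_of_nonneg_left ?_ measureReal_nonneg
  calc ∏ k ∈ Finset.range K, (1 - (bondPercolation (zdGraph 2) p).real (G k))
      ≤ ∏ _k ∈ Finset.range K, (1 - c) :=
        Finset.prod_le_prod (fun k _ => sub_nonneg.2 measureReal_le_one) fun k hk =>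
          sub_le_sub_left (hc k (Finset.mem_range.1 hk)) 1
    _ = (1 - c) ^ K := by rw [Finset.prod_const, Finset.card_range]

/-! ### The frontier event against ring events read on fresh pairs -/

variable {M N : ℕ} {S : Finset (Sym2 (Site 2))}

/-- **Failure of all the opened-on ring events costs `(1 - c)^K` on the frontier event.**  For a
frontier set `S`, increasing events `A_k` determined by pairwise disjoint sets of pairs `P_k`,
each of probability `≥ c`: `P_p(E_S ∩ ⋂_{k<K} (openedOn B_S A_k)ᶜ) ≤ P_p(E_S) (1 - c)^K`, where
`B_S = belowPairs M N S` (Nolin: "percolation above remains unbiased", the RSW circuits in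
`-C log η` disjoint annuli). [cite: Nolin2008, §4.4, proof of Lemma 15 (arXiv 0711.4948: Lemma 14, p. 11)] -/
theorem real_frontierEvent_inter_biInter_compl_openedOn_le (p : unitInterval) (hS : IsFrontierSet M N S)
    (hM : 1 ≤ M) (A : ℕ → Set (BondConfig (Site 2))) (P : ℕ → Finset (Sym2 (Site 2)))
    (hA : ∀ k, IsUpperSet (A k)) (hP : ∀ k, DeterminedBy (A k) ↑(P k))
    (hPP : ∀ k l, k ≠ l → Disjoint (P k) (P l)) {K : ℕ} {c : ℝ}
    (hc : ∀ k < K, c ≤ (bondPercolation (zdGraph 2) p).real (A k)) :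
    (bondPercolation (zdGraph 2) p).real
        (frontierEvent M N S ∩ ⋂ k ∈ Finset.range K, (openedOn (belowPairs M N S) (A k))ᶜ) ≤
      (bondPercolation (zdGraph 2) p).real (frontierEvent M N S) * (1 - c) ^ K := by
  refine real_inter_biInter_compl_le p (determinedBy_frontierEvent hS hM) (measurableSet_frontierEvent hS hM)
    (fun k => openedOn (belowPairs M N S) (A k)) (fun k => P k \ belowPairs M N S)
    (fun k => determinedBy_openedOn (hP k) _) (fun k => measurableSet_openedOn (hP k) _)
    (fun k => Finset.sdiff_disjoint) (fun k l hkl => ?_) fun k hk => (hc k hk).trans ?_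
  · exact disjoint_of_subset_left Finset.sdiff_subset (disjoint_of_subset_right Finset.sdiff_subset (hPP k l hkl))
  · exact measureReal_mono (subset_openedOn (hA k) _)

/-- **Failure of all the closed-on ring events costs `(1 - c)^K` on the frontier event**
(decreasing events `A_k`, e.g. closed dual crossings). [cite: Nolin2008, §4.4, proof of Lemma 15 (arXiv 0711.4948: Lemma 14, p. 11)] -/
theorem real_frontierEvent_inter_biInter_compl_closedOn_le (p : unitInterval) (hS : IsFrontierSet M N S)
    (hM : 1 ≤ M) (A : ℕ → Set (BondConfig (Site 2))) (P : ℕ → Finset (Sym2 (Site 2)))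
    (hA : ∀ k, IsLowerSet (A k)) (hP : ∀ k, DeterminedBy (A k) ↑(P k))
    (hPP : ∀ k l, k ≠ l → Disjoint (P k) (P l)) {K : ℕ} {c : ℝ}
    (hc : ∀ k < K, c ≤ (bondPercolation (zdGraph 2) p).real (A k)) :
    (bondPercolation (zdGraph 2) p).real
        (frontierEvent M N S ∩ ⋂ k ∈ Finset.range K, (closedOn (belowPairs M N S) (A k))ᶜ) ≤
      (bondPercolation (zdGraph 2) p).real (frontierEvent M N S) * (1 - c) ^ K := by
  refine real_inter_biInter_compl_le p (determinedBy_frontierEvent hS hM) (measurableSet_frontierEvent hS hM)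
    (fun k => closedOn (belowPairs M N S) (A k)) (fun k => P k \ belowPairs M N S)
    (fun k => determinedBy_closedOn (hP k) _) (fun k => measurableSet_closedOn (hP k) _)
    (fun k => Finset.sdiff_disjoint) (fun k l hkl => ?_) fun k hk => (hc k hk).trans ?_
  · exact disjoint_of_subset_left Finset.sdiff_subset (disjoint_of_subset_right Finset.sdiff_subset (hPP k l hkl))
  · exact measureReal_mono (subset_closedOn (hA k) _)

/-- **On an opened-on crossing event the fresh part of the crossing is open.**  If
`ω ∈ openedOn B_S A` then the completed configuration `ω ∪ B_S` lies in `A`, and each of its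
edges that is not a below pair of `S` is open in `ω` (`mem_of_mem_union_of_not_mem`): this is how
the walk of `LowPath.exists_tipCatch`, applied to `ω ∪ B_S`, is open in `ω`
(`not_mem_belowPairs_of_fresh`). [folklore] -/
theorem mem_of_mem_openedOn_of_fresh (hS : IsFrontierSet M N S) {ω : BondConfig (Site 2)}
    (hω : ω ∈ frontierEvent M N S) {p : Site 2}
    (hp : (M : ℤ) < p 0 ∨ IsAboveVertex M N (clusterConfig M N ω S) p) {e : Sym2 (Site 2)}
    (he : e ∈ (zdGraph 2).edgeSet) (hpe : p ∈ e) (heω : e ∈ ω ∪ ↑(belowPairs M N S)) : e ∈ ω :=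
  mem_of_mem_union_of_not_mem heω (not_mem_belowPairs_of_fresh hS hω hp he hpe)

end Literature.Probability.Percolation

end
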